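import Literature.Analysis.FluidPDE.Seregin2020CubicLowerBound
import HarnessLib

/-!
# Shelf 1574, line `sparse_sieve`: the DISSIPATION QUANTUM (quantitative ε-regularity in the
# `E`-currency under uniform scaled bounds)

Helper file (`--supports stmt-NavierStokesRegularity-1574 --as helper`). The mechanism behind the
CHARACTERISATION half of the line card `Cruxes/EnstrophyQuarterLaw/Lines/sparse_sieve.md` ("conversely
`EnergyHalfHolder ⇒ UniformSparseness` by the **dissipation quantum**: a `γ`-concentrating ball at scale `r`
whose scaled dissipation `E(z, r)` were `< ε(γ)` would be regular-and-small"), kernel-checked in the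
Caffarelli–Kohn–Nirenberg vocabulary of the tree (`cknAEss = A`, `cknE = E`, `cknC = C`, `cknD = D`,
backward cylinders `Q_r(z)`, suitable weak solutions with `ν = 1`):

* `small_of_cknE_le` — for every a-priori level `L` and every target `l > 0` there are a dissipation
  threshold `η = η(L, l) > 0` and a scale ratio `ϑ = ϑ(L, l) ∈ (0, 1]` such that: if `(u, p)` is a
  suitable weak solution on an open `Q ⊇ Q_ϱ(z)` (open inclusion — `z` may sit on the top of `Q`), `G` a
  weak spatial gradient, `A(ϱ; z) ≤ L`, `D(r; z) ≤ L` for `0 < r ≤ ϱ`, and `E(ϱ; z) ≤ η`, then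
  `|u| ≤ l / (ϑ ϱ)` a.e. on `Q_{ϑϱ/2}(z)`.

PROOF (three tree estimates, no new analysis): (1) Seregin's decay interpolation
`C(θ₁ϱ) ≤ C₆[θ₁³ A(ϱ)^{3/2} + θ₁⁻³ A(ϱ)^{3/4} E(ϱ)^{3/4}]` (`Seregin2020.exists_cknC_le_decay`, Seregin 2014
L. 6.2) makes `C(θ₁ϱ) ≤ κ` once `θ₁ = θ₁(L, κ)` and then `η = η(L, κ, θ₁)` are small; (2) the
Seregin–Šverák pressure decay `D(θr) ≤ c(θ D(r) + θ⁻² C(r))` (`seregin_sverak_pressure_decay_holds.ratio`)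
with `D(r) ≤ L`, `C(r) ≤ κ` at `r = θ₁ϱ` gives `C(θr) + D(θr) ≤ l₀³` for `θ = θ(L, l₀)`, `κ = κ(L, l₀, θ)`
(the arithmetic is `Seregin2020.const_ineq`, exactly as in the tree's `exists_le_cknC_of_isBackwardSingularPoint`);
(3) the one-scale ε-regularity criterion at cylinders touching the top
(`Seregin2020.exists_epsilonRegularity_top`, CKN Prop. 1 / Seregin 2020 Prop. 1.4 (1)) bounds
`|u| ≤ C₀ l₀/(θθ₁ϱ)` a.e. on `Q_{θθ₁ϱ/2}(z)`; `l₀ = min(ε₀, l/C₀)`.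

Use on the shelf: with the centre-uniform scaled bounds `A + E + C + D ≤ KS` that the window quarter law
provides on the late slab (`…EnstrophyQuarterLawLocalTypeI`, via `Seregin2020.scaledEnergies_bounded_of_cknE_le_unif`),
an `ε₀`-concentrating ball `∫_{B_{2r}(x)} |u(t)|³ ≥ ε₀³` forces `E ≥ η(KS, ·)` on the backward cylinders above
it, and the window law `∫_{t−r²}^{t} ∫ |∇u|² ≤ K r` then caps the number of `4r`-separated such balls at the
scales where the resolution ratio `ϑ` is affordable — the counting half of "`EnstrophyQuarterLaw ⇒
UniformSparseness`" (stub S2 of `Lines/sparse_sieve.lean` as a no-loss cut) is NOT in this file.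

HONEST FRAMING: known mathematics (CKN 1982 / Seregin 2007, 2014, 2020) assembled from tree theorems; nothing
here bears on the regularity problem; `EnstrophyQuarterLaw` (1574) and `UniformSparseness` stay OPEN. No summit
statement is proved.

## References

* L. Caffarelli, R. Kohn, L. Nirenberg, Comm. Pure Appl. Math. 35 (1982), Proposition 1.
* G. Seregin, *Lecture notes on regularity theory for the Navier–Stokes equations* (2014), Lemma 6.2.
* G. Seregin, V. Šverák, arXiv:0804.1803, proof of Lemma 3.5, (as13).
* G. Seregin, arXiv:2001.07382 (2020), Prop. 1.4 (1).
-/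

noncomputable section

-- the summit-side namespace repeats a component by design (D-0017)
set_option linter.dupNamespace false

namespace Summit.NavierStokesRegularity.NavierStokesRegularity.Theorems.EnstrophyQuarterLaw.DissipationQuantum

open Set MeasureTheory Function Metric Filter Topology TopologicalSpace
open scoped ENNReal NNReal
open Literature.Analysis.FluidPDE

/-! ### Arithmetic of the thresholds -/

/-- If `0 ≤ x ≤ κ / (2 (a + 1) (b + 1))` with `a, b ≥ 0`, then `a · b · x ≤ κ / 2`. [folklore] -/
theorem mul_mul_le_half {a b x κ : ℝ} (ha : 0 ≤ a) (hb : 0 ≤ b) (hx : 0 ≤ x)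
    (hle : x ≤ κ / (2 * (a + 1) * (b + 1))) : a * b * x ≤ κ / 2 := by
  have hab : a * b ≤ (a + 1) * (b + 1) := by nlinarith
  have hpos : 0 < 2 * (a + 1) * (b + 1) := by positivity
  have hκ : 0 ≤ κ := by
    have : 0 ≤ κ / (2 * (a + 1) * (b + 1)) := hx.trans hle
    exact (div_nonneg_iff.1 this).elim (fun h => h.1) (fun h => absurd h.2 (not_le.2 hpos))
  calc a * b * x ≤ (a + 1) * (b + 1) * x := mul_le_mul_of_nonneg_right hab hx
    _ ≤ (a + 1) * (b + 1) * (κ / (2 * (a + 1) * (b + 1))) :=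
        mul_le_mul_of_nonneg_left hle (by positivity)
    _ = κ / 2 := by field_simp

/-- The `ℝ≥0∞` right-hand side of Seregin's decay interpolation, with `A ≤ L` and `E^{3/4} ≤ m`
substituted, is `ofReal` of the corresponding real expression. [folklore] -/
theorem interpolation_rhs_eq_ofReal (C₆ L : ℝ≥0) {θ₁ m : ℝ} (hθ₁ : 0 < θ₁) (hm : 0 ≤ m) :
    (C₆ : ℝ≥0∞) * (ENNReal.ofReal θ₁ ^ 3 * (L : ℝ≥0∞) ^ (3 / 2 : ℝ) +
        ENNReal.ofReal θ₁⁻¹ ^ 3 * (L : ℝ≥0∞) ^ (3 / 4 : ℝ) * ENNReal.ofReal m) =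
      ENNReal.ofReal ((C₆ : ℝ) * (θ₁ ^ 3 * (L : ℝ) ^ (3 / 2 : ℝ) +
        θ₁⁻¹ ^ 3 * (L : ℝ) ^ (3 / 4 : ℝ) * m)) := by
  have hL : (L : ℝ≥0∞) = ENNReal.ofReal (L : ℝ) := (ENNReal.ofReal_coe_nnreal).symm
  have hC : (C₆ : ℝ≥0∞) = ENNReal.ofReal (C₆ : ℝ) := (ENNReal.ofReal_coe_nnreal).symm
  have hL32 : (L : ℝ≥0∞) ^ (3 / 2 : ℝ) = ENNReal.ofReal ((L : ℝ) ^ (3 / 2 : ℝ)) := by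
    rw [hL, ENNReal.ofReal_rpow_of_nonneg L.coe_nonneg (by norm_num)]
  have hL34 : (L : ℝ≥0∞) ^ (3 / 4 : ℝ) = ENNReal.ofReal ((L : ℝ) ^ (3 / 4 : ℝ)) := by
    rw [hL, ENNReal.ofReal_rpow_of_nonneg L.coe_nonneg (by norm_num)]
  have h1 : (0 : ℝ) ≤ θ₁ ^ 3 := by positivity
  have h2 : (0 : ℝ) ≤ θ₁⁻¹ ^ 3 := by positivity
  have h3 : (0 : ℝ) ≤ (L : ℝ) ^ (3 / 2 : ℝ) := by positivity
  have h4 : (0 : ℝ) ≤ (L : ℝ) ^ (3 / 4 : ℝ) := by positivity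
  rw [hL32, hL34, hC, ← ENNReal.ofReal_pow hθ₁.le, ← ENNReal.ofReal_pow (inv_pos.2 hθ₁).le,
    ← ENNReal.ofReal_mul h1, ← ENNReal.ofReal_mul h2, ← ENNReal.ofReal_mul (mul_nonneg h2 h4),
    ← ENNReal.ofReal_add (mul_nonneg h1 h3) (mul_nonneg (mul_nonneg h2 h4) hm),
    ← ENNReal.ofReal_mul C₆.coe_nonneg]

/-! ### The dissipation quantum -/

/-- **Quantitative ε-regularity in the `E`-currency under uniform scaled bounds (the dissipation
quantum).** For every level `L` and target `l > 0` there are `η > 0` and `ϑ ∈ (0, 1]` such that: for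
every suitable weak solution `(u, p)` (`ν = 1`, no force) on an open `Q`, every weak spatial gradient
`G` of `u` on `Q`, every backward cylinder `Q_ϱ(z) ⊆ Q` (open inclusion) with `A(ϱ; z) ≤ L`,
`D(r; z) ≤ L` for all `0 < r ≤ ϱ`, and `E(ϱ; z) ≤ η`, one has `|u| ≤ l/(ϑϱ)` a.e. on `Q_{ϑϱ/2}(z)`.
Contrapositive reading: under centre-uniform scaled bounds, a cylinder over which `u` is NOT small at
resolution `ϑϱ` dissipates at least `η ϱ`. (Seregin 2014 L. 6.2 interpolation; Seregin–Šverák pressure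
decay; CKN Prop. 1 in Seregin 2020's top-cylinder form — all tree theorems.)
[cite: Seregin2014, Lemma 6.2; SereginSverak2009, proof of Lemma 3.5 (as13); Seregin2020, Prop. 1.4 (1); CaffarelliKohnNirenberg1982, Proposition 1] -/
theorem small_of_cknE_le (L : ℝ≥0) {l : ℝ} (hl : 0 < l) :
    ∃ η ϑ : ℝ, 0 < η ∧ 0 < ϑ ∧ ϑ ≤ 1 ∧
      ∀ (Q : Opens (ℝ × EuclideanSpace ℝ (Fin 3)))
        (u : ℝ → EuclideanSpace ℝ (Fin 3) → EuclideanSpace ℝ (Fin 3))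
        (p : ℝ → EuclideanSpace ℝ (Fin 3) → ℝ)
        (G : ℝ → EuclideanSpace ℝ (Fin 3) → EuclideanSpace ℝ (Fin 3) →L[ℝ] EuclideanSpace ℝ (Fin 3)),
        IsSuitableWeakSolutionOn Q 1 0 u p → HasWeakSpatialGradientOn Q u G →
        ∀ (z : ℝ × EuclideanSpace ℝ (Fin 3)) (ϱ : ℝ), 0 < ϱ →
          parabolicCylinder ϱ z ⊆ (Q : Set (ℝ × EuclideanSpace ℝ (Fin 3))) →
          cknAEss ϱ z u ≤ L → (∀ r ∈ Ioc (0 : ℝ) ϱ, cknD r z p ≤ L) →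
          cknE ϱ z G ≤ ENNReal.ofReal η →
          ∀ᵐ w ∂(volume.restrict (parabolicCylinder (ϑ * ϱ / 2) z)), ‖u w.1 w.2‖ ≤ l / (ϑ * ϱ) := by
  obtain ⟨ε₀, C₀, hε₀, hC₀, Hreg⟩ := Seregin2020.exists_epsilonRegularity_top
  obtain ⟨c, Hdec⟩ := seregin_sverak_pressure_decay_holds.ratio
  obtain ⟨C₆, hC₆⟩ := Seregin2020.exists_cknC_le_decay
  -- ### the level `l₀` at which the one-scale criterion is applied
  set l₀ : ℝ := min ε₀ (l / C₀) with hl₀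
  have hl₀pos : 0 < l₀ := lt_min hε₀ (div_pos hl hC₀)
  have hl₀ε : l₀ ≤ ε₀ := min_le_left _ _
  have hC₀l₀ : C₀ * l₀ ≤ l := by
    have h1 : C₀ * l₀ ≤ C₀ * (l / C₀) := mul_le_mul_of_nonneg_left (min_le_right _ _) hC₀.le
    rwa [mul_div_cancel₀ _ hC₀.ne'] at h1
  set η₃ : ℝ := l₀ ^ 3 with hη₃
  have hη₃pos : 0 < η₃ := pow_pos hl₀pos 3
  -- ### the pressure step: ratio `θ`, cubic threshold `κ`
  set θ : ℝ := min (1 / 2) (η₃ / (4 * ((c : ℝ) + 1) * ((L : ℝ) + 1))) with hθ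
  have hθpos : 0 < θ := lt_min (by norm_num) (by positivity)
  have hθ1 : θ ≤ 1 := (min_le_left _ _).trans (by norm_num)
  set κ : ℝ := η₃ * θ ^ 2 / (4 * ((c : ℝ) + 1)) with hκ
  have hκpos : 0 < κ := by positivity
  -- ### the interpolation step: ratio `θ₁`, dissipation threshold `η = m⁴`
  set θ₁ : ℝ := min 1 (κ / (2 * ((C₆ : ℝ) + 1) * ((L : ℝ) ^ (3 / 2 : ℝ) + 1))) with hθ₁
  have hθ₁pos : 0 < θ₁ := lt_min one_pos (by positivity)
  have hθ₁1 : θ₁ ≤ 1 := min_le_left _ _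
  set m : ℝ := min 1 (κ * θ₁ ^ 3 / (2 * ((C₆ : ℝ) + 1) * ((L : ℝ) ^ (3 / 4 : ℝ) + 1))) with hm
  have hmpos : 0 < m := lt_min one_pos (by positivity)
  have hm1 : m ≤ 1 := min_le_left _ _
  refine ⟨m ^ 4, θ * θ₁, by positivity, mul_pos hθpos hθ₁pos,
    (mul_le_one₀ hθ1 hθ₁pos.le hθ₁1), fun Q u p G hsw hG z ϱ hϱ hQ hA hD hE => ?_⟩
  -- ### scales and finiteness
  set r : ℝ := θ₁ * ϱ with hr
  have hr0 : 0 < r := mul_pos hθ₁pos hϱ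
  have hrϱ : r ≤ ϱ := mul_le_of_le_one_left hϱ.le hθ₁1
  have hθr : 0 < θ * r := mul_pos hθpos hr0
  have hsubr : parabolicCylinder r z ⊆ (Q : Set (ℝ × EuclideanSpace ℝ (Fin 3))) :=
    (parabolicCylinder_mono hr0.le hrϱ z).trans hQ
  have hAtop : cknAEss ϱ z u ≠ ∞ := ne_top_of_le_ne_top ENNReal.coe_ne_top hA
  have hEtop : cknE ϱ z G ≠ ∞ := ne_top_of_le_ne_top ENNReal.ofReal_ne_top hE
  have hDtop : cknD ϱ z p ≠ ∞ := ne_top_of_le_ne_top ENNReal.coe_ne_top (hD ϱ ⟨hϱ, le_rfl⟩)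
  -- ### (1) the cubic quantity at the scale `r = θ₁ ϱ`, by the decay interpolation
  have hE34 : cknE ϱ z G ^ (3 / 4 : ℝ) ≤ ENNReal.ofReal m := by
    refine (ENNReal.rpow_le_rpow hE (by norm_num)).trans ?_
    rw [ENNReal.ofReal_rpow_of_nonneg (by positivity) (by norm_num)]
    refine ENNReal.ofReal_le_ofReal ?_
    have e : (m ^ 4) ^ (3 / 4 : ℝ) = m ^ 3 := by
      rw [← Real.rpow_natCast m 4, ← Real.rpow_mul hmpos.le, ← Real.rpow_natCast m 3]
      norm_num
    rw [e]
    calc m ^ 3 = m * (m * m) := by ring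
      _ ≤ m * (1 * 1) := by
          refine mul_le_mul_of_nonneg_left ?_ hmpos.le
          exact mul_le_mul hm1 hm1 hmpos.le zero_le_one
      _ = m := by ring
  have hCr : cknC r z u ≤ ENNReal.ofReal κ := by
    have hGϱ : HasWeakSpatialGradientOn (parabolicCylinderOpens ϱ z) u G := hG.mono (fun w hw => hQ hw)
    have key := hC₆ u G z ϱ r hr0 hrϱ hGϱ hAtop hEtop
    have e1 : r / ϱ = θ₁ := by rw [hr]; field_simp
    have e2 : ϱ / r = θ₁⁻¹ := by rw [hr]; field_simp
    rw [e1, e2] at key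
    refine key.trans ?_
    calc (C₆ : ℝ≥0∞) * (ENNReal.ofReal θ₁ ^ 3 * cknAEss ϱ z u ^ (3 / 2 : ℝ) +
          ENNReal.ofReal θ₁⁻¹ ^ 3 * cknAEss ϱ z u ^ (3 / 4 : ℝ) * cknE ϱ z G ^ (3 / 4 : ℝ))
        ≤ (C₆ : ℝ≥0∞) * (ENNReal.ofReal θ₁ ^ 3 * (L : ℝ≥0∞) ^ (3 / 2 : ℝ) +
          ENNReal.ofReal θ₁⁻¹ ^ 3 * (L : ℝ≥0∞) ^ (3 / 4 : ℝ) * ENNReal.ofReal m) := by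
          gcongr
      _ = ENNReal.ofReal ((C₆ : ℝ) * (θ₁ ^ 3 * (L : ℝ) ^ (3 / 2 : ℝ) +
          θ₁⁻¹ ^ 3 * (L : ℝ) ^ (3 / 4 : ℝ) * m)) := interpolation_rhs_eq_ofReal C₆ L hθ₁pos hmpos.le
      _ ≤ ENNReal.ofReal κ := by
          refine ENNReal.ofReal_le_ofReal ?_
          have hC6 : (0 : ℝ) ≤ C₆ := C₆.coe_nonneg
          have hL32 : (0 : ℝ) ≤ (L : ℝ) ^ (3 / 2 : ℝ) := by positivity
          have hL34 : (0 : ℝ) ≤ (L : ℝ) ^ (3 / 4 : ℝ) := by positivity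
          -- first term: `θ₁³ ≤ θ₁ ≤ κ / (2 (C₆+1) (L^{3/2}+1))`
          have hθ₁3 : θ₁ ^ 3 ≤ θ₁ := by
            calc θ₁ ^ 3 = θ₁ * (θ₁ * θ₁) := by ring
              _ ≤ θ₁ * (1 * 1) := by
                  refine mul_le_mul_of_nonneg_left ?_ hθ₁pos.le
                  exact mul_le_mul hθ₁1 hθ₁1 hθ₁pos.le zero_le_one
              _ = θ₁ := by ring
          have t1 : (C₆ : ℝ) * (L : ℝ) ^ (3 / 2 : ℝ) * θ₁ ^ 3 ≤ κ / 2 := by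
            refine le_trans (mul_le_mul_of_nonneg_left hθ₁3 (mul_nonneg hC6 hL32)) ?_
            exact mul_mul_le_half hC6 hL32 hθ₁pos.le (min_le_right _ _)
          -- second term: `m ≤ κ θ₁³ / (2 (C₆+1) (L^{3/4}+1))`
          have t2 : (C₆ : ℝ) * (L : ℝ) ^ (3 / 4 : ℝ) * (θ₁⁻¹ ^ 3 * m) ≤ κ / 2 := by
            have hθ₁3pos : 0 < θ₁ ^ 3 := pow_pos hθ₁pos 3
            have hm' : θ₁⁻¹ ^ 3 * m ≤ κ / (2 * ((C₆ : ℝ) + 1) * ((L : ℝ) ^ (3 / 4 : ℝ) + 1)) := by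
              have h1 : θ₁⁻¹ ^ 3 * m ≤ θ₁⁻¹ ^ 3 *
                  (κ * θ₁ ^ 3 / (2 * ((C₆ : ℝ) + 1) * ((L : ℝ) ^ (3 / 4 : ℝ) + 1))) :=
                mul_le_mul_of_nonneg_left (min_le_right _ _) (by positivity)
              refine h1.trans (le_of_eq ?_)
              rw [inv_pow]
              field_simp
            exact mul_mul_le_half hC6 hL34 (by positivity) hm'
          nlinarith [t1, t2]
  -- ### (2) the pressure step at the scale `θ r`
  have hDθ : cknD (θ * r) z p ≤
      (c : ℝ≥0∞) * (ENNReal.ofReal θ * L + ENNReal.ofReal (θ⁻¹ ^ 2) * ENNReal.ofReal κ) := by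
    refine (Hdec Q u p hsw.distributional z r θ hr0 hθpos hθ1 hsubr).trans ?_
    have h1 : cknD r z p ≤ L := hD r ⟨hr0, hrϱ⟩
    gcongr
  have hCθ : cknC (θ * r) z u ≤ ENNReal.ofReal (θ⁻¹ ^ 2) * ENNReal.ofReal κ := by
    have hsub : parabolicCylinder (θ * r) z ⊆ parabolicCylinder r z :=
      parabolicCylinder_mono hθr.le (mul_le_of_le_one_left hr0.le hθ1) z
    refine (Seregin2020.cknC_le_mul_of_subset hr0 hθr hsub u).trans ?_
    have e : ENNReal.ofReal (r / (θ * r)) ^ 2 = ENNReal.ofReal (θ⁻¹ ^ 2) := by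
      rw [← ENNReal.ofReal_pow (by positivity)]
      congr 1
      field_simp
    rw [e]
    gcongr
  have hsmall : cknC (θ * r) z u + cknD (θ * r) z p ≤ ENNReal.ofReal (l₀ ^ 3) := by
    have key := Seregin2020.const_ineq hη₃pos c.2 L.2 hθpos (min_le_right _ _) hκ.le
    calc cknC (θ * r) z u + cknD (θ * r) z p
        ≤ ENNReal.ofReal (θ⁻¹ ^ 2) * ENNReal.ofReal κ +
            (c : ℝ≥0∞) * (ENNReal.ofReal θ * L + ENNReal.ofReal (θ⁻¹ ^ 2) * ENNReal.ofReal κ) :=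
          add_le_add hCθ hDθ
      _ = ENNReal.ofReal ((c : ℝ) * θ * L + ((c : ℝ) + 1) * θ⁻¹ ^ 2 * κ) := by
          have hc0 : (0 : ℝ) ≤ c := c.2
          have hL0 : (0 : ℝ) ≤ L := L.2
          have hθi : (0 : ℝ) ≤ θ⁻¹ ^ 2 := by positivity
          rw [← ENNReal.ofReal_coe_nnreal (p := c), ← ENNReal.ofReal_coe_nnreal (p := L),
            ← ENNReal.ofReal_mul hθpos.le, ← ENNReal.ofReal_mul hθi, ← ENNReal.ofReal_add
              (by positivity) (by positivity), ← ENNReal.ofReal_mul hc0, ← ENNReal.ofReal_add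
              (by positivity) (by positivity)]
          congr 1
          ring
      _ ≤ ENNReal.ofReal (l₀ ^ 3) := ENNReal.ofReal_le_ofReal key
  -- ### (3) the ε-regularity criterion at the scale `θ r`, outer scale `ϱ`
  have hbound := Hreg Q u p G hsw hG z ϱ hϱ hQ hAtop hEtop hDtop (θ * r) l₀ hθr
    ((mul_le_of_le_one_left hr0.le hθ1).trans hrϱ) hl₀pos.le hl₀ε hsmall
  have e : θ * θ₁ * ϱ = θ * r := by rw [hr]; ring
  rw [e]
  filter_upwards [hbound] with w hw
  refine hw.trans ?_
  exact div_le_div_of_nonneg_right hC₀l₀ hθr.le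

end Summit.NavierStokesRegularity.NavierStokesRegularity.Theorems.EnstrophyQuarterLaw.DissipationQuantum

end
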